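import Literature.MathematicalPhysics.QuantumLattice.HubbardTorusChargeFluctuations
import Literature.MathematicalPhysics.QuantumLattice.ClusteringFromCommutatorBounds
import HarnessLib

/-!
# Exponential clustering of the gapped Hubbard torus in one coordinate direction
# (BBDF Assumption (v)) and the discharge of `bbdf2019_lsm_filling_hubbardTorus`

The named fact `bbdf2019_lsm_filling_hubbardTorus` (`HubbardLSMFilling.lean`; Bachmann–Bols–De
Roeck–Fraas, Comm. Math. Phys. **375** (2019) 1249, Theorem 2.1 with Proposition 2.4 and §3.2,
Example 2 — the Lieb–Schultz–Mattis–Oshikawa filling constraint for the Hubbard model on tori) is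
PROVED here: `bbdf2019_lsm_filling_hubbardTorus_holds`. The chain is
`ChargeIndexExactSymmetry` (Theorem 2.1 for an exact symmetry, abstract matrices) →
`HubbardLSMFillingAssembly` (§3.2 on the torus and the `O(L^{-∞})` bookkeeping:
`bbdf2019_lsm_filling_of_inputs`) → `HubbardTorusChargeFluctuations` (Prop. 2.4, Assumption (iv):
`bbdf2019_lsm_filling_of_clustering`) → this file, which supplies the last input, BBDF's
Assumption (v): exponential clustering of the unique gapped ground state in the `x_{i₀}`-direction,
uniformly in the volume ("proved in [Hastings 2004], see also [Nachtergaele–Sims 2007]", BBDF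
proof of Prop. 2.4; here from the Hastings–Koma assembly of the tree):

* `norm_commutator_hubbardTorusWith_le` — the Lipschitz input `‖[H, B]‖ ≤ N_T · 2J ‖B‖`;
* `norm_commutator_evolution_slabs_le` — the two-sided fermionic Lieb–Robinson bound between even
  observables of two slabs at periodic distance `r`: `‖[τ_u(B), A]‖ ≤ 4J N_T ‖B‖‖A‖ e^{-((r-1)-(κ+1)|u|)}`
  (`fermion_lieb_robinson_hamiltonianWith` with the level functions `clevel (coordZ i₀)` of
  `CoordinateSlabs`, `|u|e^{κ|u|} ≤ e^{(κ+1)|u|}`);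
* `clustering_hubbardTorus_pinned` / `clustering_hubbardTorus` — clustering from
  `clustering_of_commutator_bounds` (`ClusteringFromCommutatorBounds.lean`, Hastings–Koma Thm. 8 in
  generic form), with `N_T = (2d+1)L^d`, `r₀ = ⌈2(κ+1)⌉ + 2`, `ξ = max(8, 4(κ+1)/g)`, the empty-slab
  cases being scalar observables;
* `bbdf2019_lsm_filling_hubbardTorus_holds`.

Design note (instances): as in `HubbardTorusChargeFluctuations`, the analysis is elaborated with the
`DecidableEq` instances of the torus pinned to the ones derived from the linear order
(`section Pinned`, `attribute [local instance]`), and the volume-uniform statement is transported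
to the ambient instances with `convert` (`section Unpinned`).

## References

* S. Bachmann, A. Bols, W. De Roeck, M. Fraas, Comm. Math. Phys. **375** (2019) 1249–1272,
  arXiv:1810.07351: Theorem 2.1, Proposition 2.4 (Assumptions (iv), (v)), §3.2 (Example 2).
  [BachmannEtAl2019]
* M. B. Hastings, T. Koma, Comm. Math. Phys. **265** (2006) 781, Thm. 8 and App. A, as formalised in
  `ClusteringFromCommutatorBounds` and `FermionLiebRobinson`. [HastingsKomaCMP2006]
-/

noncomputable section

namespace Literature.MathematicalPhysics.QuantumLattice

open Matrix Complex Finset HubbardWave0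
open scoped Matrix.Norms.L2Operator ComplexOrder

/-! ### Observables supported on the empty set are scalars -/

section Empty

variable {ι : Type*} [LinearOrder ι] [Fintype ι]

/-- The even CAR algebra of the empty orbital set is the scalars. [folklore] -/
theorem exists_eq_smul_one_of_mem_carEvenSubalgebra_empty {A : Matrix (Finset ι) (Finset ι) ℂ}
    (hA : A ∈ carEvenSubalgebra (∅ : Finset ι)) : ∃ c : ℂ, A = c • (1 : Matrix (Finset ι) (Finset ι) ℂ) := by
  have hgen : carEvenGenerators (∅ : Finset ι) = ∅ := by
    ext M
    simp only [carEvenGenerators, Finset.notMem_empty, false_and, exists_false, Set.mem_setOf_eq,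
      Set.mem_empty_iff_false]
  have h : carEvenSubalgebra (∅ : Finset ι) = ⊥ := by
    rw [carEvenSubalgebra, hgen, Algebra.adjoin_empty]
  rw [h, Algebra.mem_bot] at hA
  obtain ⟨c, rfl⟩ := hA
  exact ⟨c, Algebra.algebraMap_eq_smul_one c⟩

/-- `orbSet ∅ = ∅`. [folklore] -/
theorem orbSet_empty {Λ : Type*} [LinearOrder Λ] [Fintype Λ] : orbSet (∅ : Finset Λ) = ∅ := by
  ext k; simp [mem_orbSet]

end Empty

/-! ### Clustering in the `x_{i₀}`-direction on the torus (pinned instances) -/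

section Pinned

open FermionTorus

attribute [local instance] instDecidableEqOrbFermionTorus instDecidableEqFermionTorus'

variable {d L : ℕ}

/-- `|u| e^{κ|u|} ≤ e^{(κ+1)|u|}` (private copy of `abs_mul_exp_le` of `ChargeTransportLocality`,
not imported here). [folklore] -/
private theorem abs_mul_exp_le' (κ u : ℝ) : |u| * Real.exp (κ * |u|) ≤ Real.exp ((κ + 1) * |u|) := by
  have h1 : |u| ≤ Real.exp |u| := by linarith [Real.add_one_le_exp |u|, abs_nonneg u]
  calc |u| * Real.exp (κ * |u|) ≤ Real.exp |u| * Real.exp (κ * |u|) :=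
        mul_le_mul_of_nonneg_right h1 (Real.exp_nonneg _)
    _ = Real.exp ((κ + 1) * |u|) := by rw [← Real.exp_add]; ring_nf

/-- The fermionic torus has `L^d` sites. [folklore] -/
private theorem card_fermionTorus_eq' (d L : ℕ) : Fintype.card (FermionTorus d L) = L ^ d := by
  change Fintype.card (Fin d → Fin L) = L ^ d
  rw [Fintype.card_fun, Fintype.card_fin, Fintype.card_fin]

variable [NeZero L]

omit [NeZero L] in
/-- **Crude locality of the commutator with the Hamiltonian**: `‖[H, B]‖ ≤ N_T · 2J ‖B‖`
(term by term). [folklore] -/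
theorem norm_commutator_hubbardTorusWith_le (t U μ : ℝ) {NT : ℕ}
    (hNT : Fintype.card (HubbardIdx (fermionTorusGraph d L)) ≤ NT)
    (B : Matrix (Finset (Orb (FermionTorus d L))) (Finset (Orb (FermionTorus d L))) ℂ) :
    ‖hubbardTorusWith d L t U μ * B - B * hubbardTorusWith d L t U μ‖ ≤
      2 * ‖B‖ * (NT * (2 * |t| + |U| + 2 * |μ|)) := by
  set G := fermionTorusGraph d L
  have hH : hubbardTorusWith d L t U μ = ∑ Z, hubbardTermOp G t U μ Z := (sum_hubbardTermOp G t U μ).symm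
  rw [hH, Finset.sum_mul, Finset.mul_sum, ← Finset.sum_sub_distrib]
  have hNT' : (Fintype.card (HubbardIdx G) : ℝ) ≤ NT := by exact_mod_cast hNT
  calc ‖∑ Z, (hubbardTermOp G t U μ Z * B - B * hubbardTermOp G t U μ Z)‖
      ≤ ∑ Z, ‖hubbardTermOp G t U μ Z * B - B * hubbardTermOp G t U μ Z‖ := norm_sum_le _ _
    _ ≤ ∑ _Z : HubbardIdx G, 2 * (2 * |t| + |U| + 2 * |μ|) * ‖B‖ := by
        refine Finset.sum_le_sum fun Z _ => ?_
        calc ‖hubbardTermOp G t U μ Z * B - B * hubbardTermOp G t U μ Z‖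
            ≤ ‖hubbardTermOp G t U μ Z * B‖ + ‖B * hubbardTermOp G t U μ Z‖ := norm_sub_le _ _
          _ ≤ ‖hubbardTermOp G t U μ Z‖ * ‖B‖ + ‖B‖ * ‖hubbardTermOp G t U μ Z‖ :=
              add_le_add (Matrix.l2_opNorm_mul _ _) (Matrix.l2_opNorm_mul _ _)
          _ ≤ (2 * |t| + |U| + 2 * |μ|) * ‖B‖ + ‖B‖ * (2 * |t| + |U| + 2 * |μ|) := by
              have h := norm_hubbardTermOp_le G t U μ Z
              exact add_le_add (mul_le_mul_of_nonneg_right h (norm_nonneg _)) (mul_le_mul_of_nonneg_left h (norm_nonneg _))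
          _ = 2 * (2 * |t| + |U| + 2 * |μ|) * ‖B‖ := by ring
    _ = Fintype.card (HubbardIdx G) * (2 * (2 * |t| + |U| + 2 * |μ|) * ‖B‖) := by
        rw [Finset.sum_const, Finset.card_univ, nsmul_eq_mul]
    _ ≤ NT * (2 * (2 * |t| + |U| + 2 * |μ|) * ‖B‖) := mul_le_mul_of_nonneg_right hNT' (by positivity)
    _ = 2 * ‖B‖ * (NT * (2 * |t| + |U| + 2 * |μ|)) := by ring

/-- **Levels of the terms meeting a slab**: if the coordinate sets `S₁`, `S₂` are at periodic
distance `≥ r`, every site of a term meeting `slab S₁` is at level `≥ r - 1` with respect to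
`slab S₂`. [folklore] -/
theorem le_level_of_meets_slab (i₀ : Fin d) {S₁ S₂ : Finset (ZMod L)} {r : ℕ}
    (hsep : ∀ z ∈ S₁, ∀ z' ∈ S₂, r ≤ circDist z z') (hne : (slab i₀ S₂ : Finset (FermionTorus d L)).Nonempty)
    {Z : HubbardIdx (fermionTorusGraph d L)} (hZ : ¬ Disjoint (hubbardTermSupp (fermionTorusGraph d L) Z) (slab i₀ S₁)) :
    r - 1 ≤ (hubbardTermSupp (fermionTorusGraph d L) Z).inf' (hubbardTermSupp_nonempty _ Z) (clevel (coordZ i₀) (slab i₀ S₂) hne) := by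
  obtain ⟨x, hxZ, hxS⟩ := Finset.not_disjoint_iff.1 hZ
  refine Finset.le_inf' _ _ fun y hy => ?_
  -- `y = x` or `y ∼ x`; the level of `x` is `≥ r`
  have hlev_x : r ≤ clevel (coordZ i₀) (slab i₀ S₂) hne x :=
    le_clevel (coordZ i₀) hne (X := slab i₀ S₁) (fun a ha b hb => hsep _ (mem_slab.1 ha) _ (mem_slab.1 hb)) hxS
  rcases eq_or_adj_of_mem_hubbardTermSupp (fermionTorusGraph d L) hy hxZ with rfl | hadj
  · omega
  · have h := clevel_le_of_adj (coordZ i₀) (isCoordFn_coordZ i₀) hne (G := fermionTorusGraph d L) hadj.symm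
    omega

/-- **Two-sided Lieb–Robinson bound between two slabs of the torus**: for even `A` of `slab S₁` and
even `B` of `slab S₂` with `S₁`, `S₂` at periodic distance `≥ r ≥ 1`, and all real `u`,
`‖[τ_u(B), A]‖ ≤ 4J N_T ‖B‖‖A‖ e^{-((r-1) - (κ+1)|u|)}`. [cite: BachmannEtAl2019, Proposition 2.4 (Assumption (v), proof)] -/
theorem norm_commutator_evolution_slabs_le (i₀ : Fin d) (t U μ : ℝ) {S₁ S₂ : Finset (ZMod L)} {r : ℕ} (hr : 1 ≤ r)
    (hsep : ∀ z ∈ S₁, ∀ z' ∈ S₂, r ≤ circDist z z')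
    (hne₁ : (slab i₀ S₁ : Finset (FermionTorus d L)).Nonempty) (hne₂ : (slab i₀ S₂ : Finset (FermionTorus d L)).Nonempty)
    {A B : Matrix (Finset (Orb (FermionTorus d L))) (Finset (Orb (FermionTorus d L))) ℂ}
    (hA : A ∈ carEvenSubalgebra (orbSet (slab i₀ S₁))) (hB : B ∈ carEvenSubalgebra (orbSet (slab i₀ S₂)))
    {NT : ℕ} (hNT : Fintype.card (HubbardIdx (fermionTorusGraph d L)) ≤ NT) (u : ℝ) :
    ‖heisenbergEvolution (hubbardTorusWith d L t U μ) u B * A - A * heisenbergEvolution (hubbardTorusWith d L t U μ) u B‖ ≤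
      4 * (2 * |t| + |U| + 2 * |μ|) * ‖B‖ * ‖A‖ * NT *
        Real.exp (-1 * (((r - 1 : ℕ) : ℝ) - (torusLRRate d t U μ + 1) * |u|)) := by
  set G := fermionTorusGraph d L with hG
  have hHG : hubbardTorusWith d L t U μ = hamiltonianWith G t U μ := rfl
  have hHh : (hubbardTorusWith d L t U μ).IsHermitian := isHermitian_hubbardTorusWith' d L t U μ
  have hΔ : ∀ x : FermionTorus d L, (Finset.univ.filter fun y => G.Adj x y).card ≤ 2 * d :=
    fun x => card_filter_fermionTorusGraph_adj_le x
  have hNT' : (Fintype.card (HubbardIdx G) : ℝ) ≤ NT := by exact_mod_cast hNT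
  have hdisj : Disjoint S₁ S₂ := by
    rw [Finset.disjoint_left]
    intro z hz hz'
    have h := hsep z hz z hz'
    rw [circDist_self] at h
    omega
  have hdisjO : Disjoint (orbSet (slab i₀ S₁ : Finset (FermionTorus d L))) (orbSet (slab i₀ S₂)) :=
    disjoint_orbSet (disjoint_slab hdisj)
  have hA' := (carEvenSubalgebra_le_carSubalgebra _) hA
  have hB' := (carEvenSubalgebra_le_carSubalgebra _) hB
  have hcommAB : A * B - B * A = 0 := sub_eq_zero.2 (commute_of_mem_carEvenSubalgebra hA hB' hdisjO).eq
  have hcommBA : B * A - A * B = 0 := sub_eq_zero.2 (commute_of_mem_carEvenSubalgebra hB hA' hdisjO.symm).eq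
  have hsep' : ∀ z' ∈ S₂, ∀ z ∈ S₁, r ≤ circDist z' z := fun z' hz' z hz => by rw [circDist_comm]; exact hsep z hz z' hz'
  have hJc : 0 ≤ 2 * |t| + |U| + 2 * |μ| := by positivity
  have hκ := torusLRRate_nonneg d t U μ
  -- the common final estimate
  have hfin : ∀ s : ℝ, 0 ≤ s → |u| = s → ∀ ℓ : ℕ, r - 1 ≤ ℓ →
      s * Real.exp (torusLRRate d t U μ * s - ℓ) ≤ Real.exp (-1 * (((r - 1 : ℕ) : ℝ) - (torusLRRate d t U μ + 1) * |u|)) := by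
    intro s hs hus ℓ hℓ
    have hℓ' : ((r - 1 : ℕ) : ℝ) ≤ ℓ := by exact_mod_cast hℓ
    have h1 := abs_mul_exp_le' (torusLRRate d t U μ) u
    rw [hus] at h1
    calc s * Real.exp (torusLRRate d t U μ * s - ℓ) = s * Real.exp (torusLRRate d t U μ * s) * Real.exp (-(ℓ : ℝ)) := by
          rw [sub_eq_add_neg, Real.exp_add]; ring
      _ ≤ Real.exp ((torusLRRate d t U μ + 1) * s) * Real.exp (-(((r - 1 : ℕ) : ℝ))) :=
          mul_le_mul h1 (Real.exp_le_exp.2 (by linarith)) (Real.exp_pos _).le (Real.exp_pos _).le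
      _ = Real.exp (-1 * (((r - 1 : ℕ) : ℝ) - (torusLRRate d t U μ + 1) * |u|)) := by
          rw [← Real.exp_add, hus]; ring_nf
  rcases le_or_gt 0 u with hu0 | hu0
  · -- `u ≥ 0`: `B` evolves, level function of `slab S₁`
    have key := fermion_lieb_robinson_hamiltonianWith G hΔ t U μ hB' hA'
      (clevel (coordZ i₀) (slab i₀ S₁) hne₁) (fun y hy => clevel_eq_zero (coordZ i₀) hne₁ hy)
      (fun x y h => clevel_le_of_adj (coordZ i₀) (isCoordFn_coordZ i₀) hne₁ h) hu0
    rw [← hHG, hcommBA, norm_zero, zero_add] at key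
    refine key.trans ?_
    have hc0 : 0 ≤ 2 * (2 * |t| + |U| + 2 * |μ|) * ‖A‖ *
        Real.exp (-1 * (((r - 1 : ℕ) : ℝ) - (torusLRRate d t U μ + 1) * |u|)) := by positivity
    have hsum := sum_filter_le_card_mul (fun Z : HubbardIdx G => ¬ Disjoint (hubbardTermSupp G Z) (slab i₀ S₂)) hc0
      (f := fun Z => 2 * (2 * |t| + |U| + 2 * |μ|) * ‖A‖ * u *
        Real.exp (Real.exp 1 * (2 * (2 * |t| + |U| + 2 * |μ|) * (2 * (2 * (2 * d) + 1) : ℕ)) * u -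
          ((hubbardTermSupp G Z).inf' (hubbardTermSupp_nonempty G Z) (clevel (coordZ i₀) (slab i₀ S₁) hne₁) : ℕ)))
      (fun Z hZ => by
        have hℓ := le_level_of_meets_slab i₀ hsep' hne₁ hZ
        have h1 := hfin u hu0 (abs_of_nonneg hu0) _ hℓ
        calc _ = 2 * (2 * |t| + |U| + 2 * |μ|) * ‖A‖ * (u * Real.exp (torusLRRate d t U μ * u -
              ((hubbardTermSupp G Z).inf' (hubbardTermSupp_nonempty G Z) (clevel (coordZ i₀) (slab i₀ S₁) hne₁) : ℕ))) := by
              rw [torusLRRate]; ring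
          _ ≤ 2 * (2 * |t| + |U| + 2 * |μ|) * ‖A‖ * Real.exp (-1 * (((r - 1 : ℕ) : ℝ) - (torusLRRate d t U μ + 1) * |u|)) :=
              mul_le_mul_of_nonneg_left h1 (by positivity))
    refine (mul_le_mul_of_nonneg_left (hsum.trans (mul_le_mul_of_nonneg_right hNT' hc0)) (by positivity)).trans (le_of_eq ?_)
    ring
  · -- `u < 0`: `A` evolves
    have hu0' : 0 ≤ -u := by linarith
    have e : u = -(-u) := by ring
    rw [e, norm_commutator_heisenbergEvolution_neg' hHh (-u) B A]
    have key := fermion_lieb_robinson_hamiltonianWith G hΔ t U μ hA' hB'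
      (clevel (coordZ i₀) (slab i₀ S₂) hne₂) (fun y hy => clevel_eq_zero (coordZ i₀) hne₂ hy)
      (fun x y h => clevel_le_of_adj (coordZ i₀) (isCoordFn_coordZ i₀) hne₂ h) hu0'
    rw [← hHG, hcommAB, norm_zero, zero_add] at key
    refine key.trans ?_
    have hus : |u| = -u := abs_of_neg hu0
    have hc0 : 0 ≤ 2 * (2 * |t| + |U| + 2 * |μ|) * ‖B‖ *
        Real.exp (-1 * (((r - 1 : ℕ) : ℝ) - (torusLRRate d t U μ + 1) * |u|)) := by positivity
    have hsum := sum_filter_le_card_mul (fun Z : HubbardIdx G => ¬ Disjoint (hubbardTermSupp G Z) (slab i₀ S₁)) hc0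
      (f := fun Z => 2 * (2 * |t| + |U| + 2 * |μ|) * ‖B‖ * (-u) *
        Real.exp (Real.exp 1 * (2 * (2 * |t| + |U| + 2 * |μ|) * (2 * (2 * (2 * d) + 1) : ℕ)) * (-u) -
          ((hubbardTermSupp G Z).inf' (hubbardTermSupp_nonempty G Z) (clevel (coordZ i₀) (slab i₀ S₂) hne₂) : ℕ)))
      (fun Z hZ => by
        have hℓ := le_level_of_meets_slab i₀ hsep hne₂ hZ
        have h1 := hfin (-u) hu0' hus _ hℓ
        calc _ = 2 * (2 * |t| + |U| + 2 * |μ|) * ‖B‖ * ((-u) * Real.exp (torusLRRate d t U μ * (-u) -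
              ((hubbardTermSupp G Z).inf' (hubbardTermSupp_nonempty G Z) (clevel (coordZ i₀) (slab i₀ S₂) hne₂) : ℕ))) := by
              rw [torusLRRate]; ring
          _ ≤ 2 * (2 * |t| + |U| + 2 * |μ|) * ‖B‖ * Real.exp (-1 * (((r - 1 : ℕ) : ℝ) - (torusLRRate d t U μ + 1) * |u|)) :=
              mul_le_mul_of_nonneg_left h1 (by positivity))
    rw [show |-(-u)| = |u| by rw [neg_neg]] 
    refine (mul_le_mul_of_nonneg_left (hsum.trans (mul_le_mul_of_nonneg_right hNT' hc0)) (by positivity)).trans (le_of_eq ?_)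
    ring

/-- **Exponential clustering of the unique gapped ground state of the Hubbard torus in the
`x_{i₀}`-direction, uniformly in the volume** (BBDF Assumption (v), which Proposition 2.4 takes from
Hastings–Koma / Nachtergaele–Sims; here from the generic Hastings–Koma assembly
`clustering_of_commutator_bounds` fed with the crude Lipschitz bound
`norm_commutator_hubbardTorusWith_le` and the two-sided slab Lieb–Robinson bound
`norm_commutator_evolution_slabs_le`), with the pinned instances: for even observables `A`, `B` of
two slabs at periodic distance `r ≥ r₀`,
`|⟨ψ,ABψ⟩ - ⟨ψ,Aψ⟩⟨ψ,Bψ⟩| ≤ C L^d ‖A‖‖B‖ e^{-r/ξ}` with `C, ξ, r₀` depending only on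
`d, t, U, μ, g` (`N_T = (2d+1)L^d`, `e^{-(r-1)/ξ} = e^{1/ξ}e^{-r/ξ}`; empty slabs carry only scalars).
[cite: BachmannEtAl2019, Proposition 2.4 (Assumption (v))] -/
theorem clustering_hubbardTorus_pinned (d : ℕ) (t U μ g : ℝ) (hg : 0 < g) :
    ∃ Ccl ξ : ℝ, ∃ r₀ : ℕ, 0 < ξ ∧ 0 ≤ Ccl ∧
      ∀ (L : ℕ) [NeZero L] (i₀ : Fin d) (ψ : Fock (Orb (FermionTorus d L))),
        (hubbardTorusWith d L t U μ).HasSpectralGap g →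
        (hubbardTorusWith d L t U μ).IsGroundStateVector ψ → star ψ ⬝ᵥ ψ = 1 →
        ∀ (S₁ S₂ : Finset (ZMod L)) (r : ℕ), r₀ ≤ r → (∀ z ∈ S₁, ∀ z' ∈ S₂, r ≤ circDist z z') →
        ∀ A ∈ carEvenSubalgebra (orbSet (slab i₀ S₁)), ∀ B ∈ carEvenSubalgebra (orbSet (slab i₀ S₂)),
          ‖star ψ ⬝ᵥ ((A * B) *ᵥ ψ) - (star ψ ⬝ᵥ (A *ᵥ ψ)) * (star ψ ⬝ᵥ (B *ᵥ ψ))‖ ≤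
            Ccl * (L : ℝ) ^ d * ‖A‖ * ‖B‖ * Real.exp (-(r : ℝ) / ξ) := by
  have hJc : 0 ≤ 2 * |t| + |U| + 2 * |μ| := by positivity
  have hκ : 0 ≤ torusLRRate d t U μ := torusLRRate_nonneg d t U μ
  have hξ : 0 < max (8 / 1) (4 * (torusLRRate d t U μ + 1) / g) := lt_max_of_lt_left (by norm_num)
  have hKc : 0 ≤ 2 + 4 * (2 * |t| + |U| + 2 * |μ|) + 4 * (4 * (2 * |t| + |U| + 2 * |μ|)) / ((torusLRRate d t U μ + 1) * 1) +
      8 * (torusLRRate d t U μ + 1) / g := by positivity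
  set Ccl : ℝ := (2 + 4 * (2 * |t| + |U| + 2 * |μ|) + 4 * (4 * (2 * |t| + |U| + 2 * |μ|)) / ((torusLRRate d t U μ + 1) * 1) +
      8 * (torusLRRate d t U μ + 1) / g) * (2 * d + 1 : ℝ) * Real.exp (1 / max (8 / 1) (4 * (torusLRRate d t U μ + 1) / g))
    with hCcl
  have hCcl0 : 0 ≤ Ccl := by positivity
  clear_value Ccl
  refine ⟨Ccl, max (8 / 1) (4 * (torusLRRate d t U μ + 1) / g), ⌈2 * (torusLRRate d t U μ + 1)⌉₊ + 2, hξ, hCcl0, ?_⟩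
  intro L _ i₀ ψ hgap hψ hψ1 S₁ S₂ r hr hsep A hA B hB
  have hr1 : 1 ≤ r := by omega
  have hRHS : 0 ≤ Ccl * (L : ℝ) ^ d * ‖A‖ * ‖B‖ * Real.exp (-(r : ℝ) / max (8 / 1) (4 * (torusLRRate d t U μ + 1) / g)) :=
    mul_nonneg (mul_nonneg (mul_nonneg (mul_nonneg hCcl0 (by positivity)) (norm_nonneg _)) (norm_nonneg _))
      (Real.exp_pos _).le
  -- the empty-slab cases: scalar observables
  by_cases hne₁ : (slab i₀ S₁ : Finset (FermionTorus d L)).Nonempty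
  swap
  · rw [Finset.not_nonempty_iff_eq_empty.1 hne₁, orbSet_empty] at hA
    obtain ⟨c, rfl⟩ := exists_eq_smul_one_of_mem_carEvenSubalgebra_empty hA
    have e : star ψ ⬝ᵥ ((c • (1 : Matrix _ _ ℂ) * B) *ᵥ ψ) -
        (star ψ ⬝ᵥ ((c • (1 : Matrix _ _ ℂ)) *ᵥ ψ)) * (star ψ ⬝ᵥ (B *ᵥ ψ)) = 0 := by
      rw [smul_mul_assoc, Matrix.one_mul, smul_mulVec, smul_mulVec, one_mulVec, dotProduct_smul,
        dotProduct_smul, hψ1, smul_eq_mul, smul_eq_mul, mul_one, sub_self]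
    rw [e, norm_zero]; exact hRHS
  by_cases hne₂ : (slab i₀ S₂ : Finset (FermionTorus d L)).Nonempty
  swap
  · rw [Finset.not_nonempty_iff_eq_empty.1 hne₂, orbSet_empty] at hB
    obtain ⟨c, rfl⟩ := exists_eq_smul_one_of_mem_carEvenSubalgebra_empty hB
    have e : star ψ ⬝ᵥ ((A * (c • (1 : Matrix _ _ ℂ))) *ᵥ ψ) -
        (star ψ ⬝ᵥ (A *ᵥ ψ)) * (star ψ ⬝ᵥ ((c • (1 : Matrix _ _ ℂ)) *ᵥ ψ)) = 0 := by
      rw [mul_smul_comm, Matrix.mul_one, smul_mulVec, smul_mulVec, one_mulVec, dotProduct_smul,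
        dotProduct_smul, hψ1, smul_eq_mul, smul_eq_mul, mul_one, mul_comm, sub_self]
    rw [e, norm_zero]; exact hRHS
  -- the main case
  have hH : (hubbardTorusWith d L t U μ).IsHermitian := isHermitian_hubbardTorusWith' d L t U μ
  set NT : ℕ := (2 * d + 1) * L ^ d with hNTdef
  have hNT : Fintype.card (HubbardIdx (fermionTorusGraph d L)) ≤ NT := card_hubbardIdx_torus_le d L
  have hL1 : 1 ≤ L := NeZero.pos L
  have hNT1 : (1 : ℝ) ≤ NT := by
    have h : 1 ≤ NT := by
      rw [hNTdef]
      exact Nat.one_le_iff_ne_zero.2 (Nat.mul_ne_zero (by omega) (pow_ne_zero d (by omega)))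
    exact_mod_cast h
  have hNTr : (NT : ℝ) = (2 * d + 1 : ℝ) * (L : ℝ) ^ d := by rw [hNTdef]; push_cast; ring
  have hdisj : Disjoint S₁ S₂ := by
    rw [Finset.disjoint_left]
    intro z hz hz'
    have h := hsep z hz z hz'
    rw [circDist_self] at h
    omega
  have hAB : Commute A B :=
    commute_of_mem_carEvenSubalgebra hA ((carEvenSubalgebra_le_carSubalgebra _) hB) (disjoint_orbSet (disjoint_slab hdisj))
  have hD : max (2 * (torusLRRate d t U μ + 1)) 1 ≤ (((r - 1 : ℕ) : ℝ)) := by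
    have h1 : ((⌈2 * (torusLRRate d t U μ + 1)⌉₊ + 2 : ℕ) : ℝ) ≤ r := by exact_mod_cast hr
    have h2 : 2 * (torusLRRate d t U μ + 1) ≤ (⌈2 * (torusLRRate d t U μ + 1)⌉₊ : ℝ) := Nat.le_ceil _
    have h3 : (((r - 1 : ℕ) : ℝ)) = (r : ℝ) - 1 := by rw [Nat.cast_sub hr1]; norm_num
    push_cast at h1
    rw [h3]
    exact max_le (by linarith) (by linarith)
  have key := clustering_of_commutator_bounds (A := A) (B := B) hH hg (by positivity : (0 : ℝ) ≤ 4 * (2 * |t| + |U| + 2 * |μ|))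
    one_pos (by linarith : (0 : ℝ) < torusLRRate d t U μ + 1) hJc hNT1 (by positivity : (0 : ℝ) ≤ NT) le_rfl hgap hψ hψ1
    hAB (norm_commutator_hubbardTorusWith_le t U μ hNT B)
    (fun u => norm_commutator_evolution_slabs_le i₀ t U μ hr1 hsep hne₁ hne₂ hA hB hNT u) hD
  change ‖star ψ ⬝ᵥ ((A * B) *ᵥ ψ) - (star ψ ⬝ᵥ (A *ᵥ ψ)) * (star ψ ⬝ᵥ (B *ᵥ ψ))‖ ≤ _ at key
  refine key.trans ?_
  have h3 : (((r - 1 : ℕ) : ℝ)) = (r : ℝ) - 1 := by rw [Nat.cast_sub hr1]; norm_num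
  have hexp : Real.exp (-(((r - 1 : ℕ) : ℝ)) / max (8 / 1) (4 * (torusLRRate d t U μ + 1) / g)) =
      Real.exp (1 / max (8 / 1) (4 * (torusLRRate d t U μ + 1) / g)) *
        Real.exp (-(r : ℝ) / max (8 / 1) (4 * (torusLRRate d t U μ + 1) / g)) := by
    rw [← Real.exp_add, h3]; congr 1; ring
  rw [hexp, hNTr, hCcl]
  refine le_of_eq ?_
  ring

end Pinned

/-! ### The clustering input with the ambient instances, and the discharge -/

section Unpinned

open FermionTorus

/-- **Exponential clustering of the unique gapped ground state of the Hubbard torus in the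
`x_{i₀}`-direction, uniformly in the volume (BBDF Assumption (v))**, in the form consumed by
`bbdf2019_lsm_filling_of_clustering` (ambient instances; transported from
`clustering_hubbardTorus_pinned` with `convert`). [cite: BachmannEtAl2019, Proposition 2.4 (Assumption (v))] -/
theorem clustering_hubbardTorus (d : ℕ) (t U μ g : ℝ) (hg : 0 < g) :
    ∃ Ccl ξ : ℝ, ∃ r₀ : ℕ, 0 < ξ ∧ 0 ≤ Ccl ∧
      ∀ (L : ℕ) [NeZero L] (i₀ : Fin d) (ψ : Fock (Orb (FermionTorus d L))),
        (hubbardTorusWith d L t U μ).HasSpectralGap g →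
        (hubbardTorusWith d L t U μ).IsGroundStateVector ψ → star ψ ⬝ᵥ ψ = 1 →
        ∀ (S₁ S₂ : Finset (ZMod L)) (r : ℕ), r₀ ≤ r → (∀ z ∈ S₁, ∀ z' ∈ S₂, r ≤ circDist z z') →
        ∀ A ∈ carEvenSubalgebra (orbSet (slab i₀ S₁)), ∀ B ∈ carEvenSubalgebra (orbSet (slab i₀ S₂)),
          ‖star ψ ⬝ᵥ ((A * B) *ᵥ ψ) - (star ψ ⬝ᵥ (A *ᵥ ψ)) * (star ψ ⬝ᵥ (B *ᵥ ψ))‖ ≤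
            Ccl * (L : ℝ) ^ d * ‖A‖ * ‖B‖ * Real.exp (-(r : ℝ) / ξ) := by
  obtain ⟨Ccl, ξ, r₀, hξ, hCcl, H⟩ := clustering_hubbardTorus_pinned d t U μ g hg
  refine ⟨Ccl, ξ, r₀, hξ, hCcl, fun L _ i₀ ψ hgap hψ hψ1 S₁ S₂ r hr hsep A hA B hB => ?_⟩
  letI : DecidableEq (Orb (FermionTorus d L)) := instDecidableEqOrbFermionTorus
  letI : DecidableEq (FermionTorus d L) := instDecidableEqFermionTorus'
  have hgap' : (hubbardTorusWith d L t U μ).HasSpectralGap g := by convert hgap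
  have hψ' : (hubbardTorusWith d L t U μ).IsGroundStateVector ψ := by convert hψ
  have h := H L i₀ ψ hgap' hψ' hψ1 S₁ S₂ r hr hsep A hA B hB
  convert h

/-- **Discharge of the named fact `bbdf2019_lsm_filling_hubbardTorus`** (Bachmann–Bols–De
Roeck–Fraas, Theorem 2.1 with Proposition 2.4 and §3.2, for the grand-canonical Hubbard
Hamiltonian on the tori `ℤ_L^d` and the conserved charges `n_{x↑}`, `n_{x↓}`): the conditional
theorem `bbdf2019_lsm_filling_of_clustering` (index theorem for the exact translation symmetry —
`ChargeIndexExactSymmetry`; §3.2 assembly and `O(L^{-∞})` bookkeeping — `HubbardLSMFillingAssembly`;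
local charge fluctuations (iv) — `HubbardTorusChargeFluctuations`) fed with the clustering input (v)
`clustering_hubbardTorus`. [cite: BachmannEtAl2019, Theorem 2.1, Proposition 2.4, §3.2 (Example 2)] -/
theorem bbdf2019_lsm_filling_hubbardTorus_holds : bbdf2019_lsm_filling_hubbardTorus :=
  bbdf2019_lsm_filling_of_clustering clustering_hubbardTorus

end Unpinned

end Literature.MathematicalPhysics.QuantumLattice

end
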